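import Summits.HodgeConjecture.CorCM.IrreducibleOddWeightsIsotypicNondegenerate
import HarnessLib

/-!
# Isotypic cells, existence XI: STABLE NONDEGENERACY OF A PRODUCT CLASS BY CLASS — `rank Σ = |⊔_i E_i|/2 + 1 ⟺`
# in every ODD isotypic class ALL components of ALL members are free over the commutant:
# `dim ⨆_{i,j} 𝒟_c·b^i_{c,j} = (Σ_i m_{i,c})·δ_c`

COR-CM (cell `pub-hodgecm2`, binder seat `b16` gen 76, count-neutral claim THE ISOTYPIC DECOMPOSITION EXISTS, file
E11 — type ranks and the CM dress; theorems only, no definition, no named fact, no `sorry`).  NEW as stated, hence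
under `Summits/`.  HONEST FRAMING: the family version of file E10.  For a family of CM types `Φ_i ⊆ E_i` the family
type `Σ` on `⊔_i E_i` is a CM type (tree `IsCMTypeWith.sigmaType`), `rank Σ − 1 = dim Hg(∏_i A_i) ≤ |⊔_i E_i|/2 =
Σ_i dim A_i`, and equality — `IsNondegenerateFamily`, i.e. the product `∏_i A_i` is STABLY NONDEGENERATE (tree
`Pohlmann1968/NondegenerateCMAlgebraTypes`: no power carries an exotic Hodge class) — is decided class by class on an
isotypic decomposition of the type vectors: gen 75 M5 gives `rank Σ − 1 = Σ_c r_c·dim A_c` with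
`dim ⨆_{i,j} 𝒟_c·b^i_{c,j} = r_c·δ_c`, `r_c ≤ Σ_i m_{i,c}`; E9 gives `r_c = 0` on even classes and `|E_i|/2 =
Σ_{c odd} m_{i,c}·dim A_c`.  Nothing about the algebraicity of Hodge classes is asserted; `HC_CM` is neither used nor
asserted.

* §1 **THE FAMILY CRITERION** (`typeRank_sigmaType_eq_iff_forall_odd_finrank_eq`): with an isotypic decomposition of
  the type vectors whose images span every slot, **`rank Σ = |⊔_i E_i|/2 + 1 ⟺ ∀ c` with `A_c` odd,
  `dim ⨆_i ⨆_j 𝒟_c·b^i_{c,j} = (Σ_i |J_{i,c}|)·δ_c`** — the components of ALL members in the class `c` are jointly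
  `𝒟_c`-free.
* §2 WITH NO INPUT BUT THE TYPES (`exists_isotypic_typeRank_sigmaType_eq_iff_forall_odd`).
* §3 CM FIELDS (`exists_isotypic_isNondegenerateFamily_iff_forall_odd`): **`∏_i A_{Φ_i}` is stably nondegenerate
  (`IsNondegenerateFamily Φ`) iff in every odd class the components of all the type vectors are jointly
  `𝒟_c`-free.**

## References

* [Kubota1965] T. Kubota, *On the field extension by complex multiplication*, Trans. AMS 118 (1965), §2.
* [Gordon1999HodgeAVSurvey] B. B. Gordon, *A survey of the Hodge conjecture for abelian varieties*, 7.5–7.6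
  (stably nondegenerate abelian varieties).
* [Milne1999LefschetzClasses] J. S. Milne, *Lefschetz classes on abelian varieties*, Duke Math. J. 96 (1999),
  Prop. 4.8.
* [Deligne1982HodgeCycles] P. Deligne, *Hodge cycles on abelian varieties*, LNM 900 (1982), I Ex. 3.7.
-/

set_option autoImplicit false

noncomputable section

open scoped BigOperators Classical

universe u uC uJ v vC w

namespace Summit.HodgeConjecture.CorCM.IrrOdd

open Literature.NumberTheory.ComplexMultiplication

variable {G : Type w} [Group G] {ρ : G}

/-! ### §1 The family criterion -/

section Family

variable {I : Type u} {E : I → Type v} [∀ i, MulAction G (E i)] [∀ i, Fintype (E i)] [Fintype I]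
  [∀ i, Nonempty (E i)]
  {C : Type uC} [Fintype C] {Yc : C → Type vC} [∀ c, MulAction G (Yc c)] [∀ c, Fintype (Yc c)]
  {Ar : ∀ c, Submodule ℚ (Yc c → ℚ)} {𝒟 : ∀ c, Submodule ℚ ((Yc c → ℚ) →ₗ[ℚ] (Yc c → ℚ))}
  {JJ : I → C → Type uJ} [∀ i c, Fintype (JJ i c)]

/-- **STABLE NONDEGENERACY CLASS BY CLASS.**  CM types `Φ_i ⊆ E_i` for `ρ` (`i ∈ I` finite, non-empty), the type
vectors decomposed over pairwise non-embeddable references `A_c ≤ ℚ^{Y_c}` (`ρ` commuting with the action and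
involutive on every `Y_c`), commutants `𝒟_c`, embeddings `ι^i_{c,j}` equivariant and jointly independent on `A_c`
whose images span every slot, components `b^i_{c,j} ∈ A_c`, non-zero `a₀_c ∈ A_c`.  Then
**`rank Σ = |⊔_i E_i|/2 + 1 ⟺` for every class `c` with `A_c` ODD,
`dim ⨆_i ⨆_j 𝒟_c·b^i_{c,j} = (Σ_i |J_{i,c}|)·dim 𝒟_c·a₀_c`**. [cite: Kubota1965, §2 (p. 115)]
[cite: Gordon1999HodgeAVSurvey, 7.5–7.6] [cite: Deligne1982HodgeCycles, I Ex. 3.7] -/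
theorem typeRank_sigmaType_eq_iff_forall_odd_finrank_eq [Nonempty I] {Φ : ∀ i, Set (E i)}
    (h : ∀ i, IsCMTypeWith ρ (Φ i))
    (hcomm : ∀ c (g : G) (y : Yc c), g • ρ • y = ρ • g • y) (hinv : ∀ c (y : Yc c), ρ • ρ • y = y)
    (h𝒟 : ∀ c (L : (Yc c → ℚ) →ₗ[ℚ] (Yc c → ℚ)), L ∈ 𝒟 c ↔ (∀ a ∈ Ar c, L a ∈ Ar c) ∧
      ∀ (k : G) (a : Yc c → ℚ), a ∈ Ar c → L (fun y => a (k • y)) = fun y => L a (k • y))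
    (hRst : ∀ c (k : G) (a : Yc c → ℚ), a ∈ Ar c → (fun y => a (k • y)) ∈ Ar c)
    (hRirr : ∀ c (W : Submodule ℚ (Yc c → ℚ)), W ≤ Ar c → W ≠ ⊥ →
      (∀ (k : G) (f : Yc c → ℚ), f ∈ W → (fun y => f (k • y)) ∈ W) → W = Ar c)
    (hsep : ∀ c c' (L : (Yc c → ℚ) →ₗ[ℚ] (Yc c' → ℚ)), c ≠ c' → Ar c ≠ ⊥ → (∀ a ∈ Ar c, L a ∈ Ar c') →
      (∀ a ∈ Ar c, L a = 0 → a = 0) →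
      (∀ (k : G) (a : Yc c → ℚ), a ∈ Ar c → L (fun y => a (k • y)) = fun y => L a (k • y)) → False)
    (ι : ∀ i c, JJ i c → ((Yc c → ℚ) →ₗ[ℚ] (E i → ℚ)))
    (hιeq : ∀ i c (j : JJ i c) (k : G) (a : Yc c → ℚ), a ∈ Ar c →
      ι i c j (fun y => a (k • y)) = fun y => ι i c j a (k • y))
    (hind : ∀ i c (f : JJ i c → (Yc c → ℚ)), (∀ j, f j ∈ Ar c) → ∑ j, ι i c j (f j) = 0 → ∀ j, f j = 0)
    {b : ∀ i c, JJ i c → (Yc c → ℚ)} (hb : ∀ i c j, b i c j ∈ Ar c)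
    (hu : ∀ i, antiVec (Φ i) (1 : G) = ∑ c, ∑ j, ι i c j (b i c j))
    {a₀ : ∀ c, Yc c → ℚ} (ha₀ : ∀ c, a₀ c ∈ Ar c) (h0 : ∀ c, a₀ c ≠ 0)
    (htop : ∀ i, (⨆ c, ⨆ j, (Ar c).map (ι i c j)) = ⊤) :
    typeRank G (sigmaType Φ) = Fintype.card (Σ i, E i) / 2 + 1 ↔
      ∀ c, Ar c ≤ antiWeights (E := Yc c) ρ →
        Module.finrank ℚ ↥(⨆ i, ⨆ j, (𝒟 c).map (LinearMap.applyₗ (b i c j))) =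
          (∑ i, Fintype.card (JJ i c)) * Module.finrank ℚ ↥((𝒟 c).map (LinearMap.applyₗ (a₀ c))) := by
  obtain ⟨r, hr, hD, hS⟩ := exists_rank_typeRank_sigmaType_eq_sum_of_classes h h𝒟 hRst hRirr hsep ι hιeq hind hb hu
    ha₀ h0
  -- `δ_c > 0`, `d_c > 0`
  have hδ : ∀ c, 0 < Module.finrank ℚ ↥((𝒟 c).map (LinearMap.applyₗ (a₀ c))) := by
    intro c
    refine Module.finrank_pos_iff_exists_ne_zero.2 ⟨⟨a₀ c, ?_⟩, fun h1 => h0 c (congrArg Subtype.val h1)⟩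
    exact Submodule.mem_map.2 ⟨LinearMap.id, (h𝒟 c _).2 ⟨fun a ha => ha, fun k a _ => rfl⟩, rfl⟩
  have hd : ∀ c, 0 < Module.finrank ℚ (Ar c) := fun c =>
    Module.finrank_pos_iff_exists_ne_zero.2 ⟨⟨a₀ c, ha₀ c⟩, fun h1 => h0 c (congrArg Subtype.val h1)⟩
  -- every type vector is odd; even classes carry no rank
  have hodd : ∀ i, (∑ c, ∑ j, ι i c j (b i c j)) ∈ antiWeights (E := E i) ρ := fun i => by
    rw [← hu i]
    exact antiVec_mem_antiWeights (h i) 1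
  have hr0 : ∀ c, ¬ Ar c ≤ antiWeights (E := Yc c) ρ → r c = 0 := by
    intro c hc
    have heven : Ar c ≤ symWeights (E := Yc c) ρ :=
      (le_symWeights_or_le_antiWeights (hcomm c) (hinv c) (hRst c) (hRirr c)).resolve_right hc
    have hb0 : ∀ i j, b i c j = 0 := fun i =>
      eq_zero_of_le_symWeights hRst hRirr hsep (ι i) (hιeq i) (hind i) (hb i) (hodd i) heven
    have h1 := hD c
    rw [show (⨆ i, ⨆ j, (𝒟 c).map (LinearMap.applyₗ (b i c j))) = ⊥ from
      iSup_eq_bot.2 fun i => iSup_map_applyₗ_eq_bot_of_forall_eq_zero (𝒟 c) (hb0 i), finrank_bot] at h1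
    exact (Nat.mul_eq_zero.1 h1.symm).resolve_right (hδ c).ne'
  -- `|⊔_i E_i|/2 = Σ_i dim Anti(E_i) = Σ_c ((Σ_i m_{i,c})·d_c if odd else 0)`
  have hhalf : ∀ i, Module.finrank ℚ (antiWeights (E := E i) ρ) = Fintype.card (E i) / 2 := fun i => by
    have h1 := card_le_two_mul_finrank_antiWeights (h i)
    have h2 := Shadow.finrank_antiWeights_le (h i)
    omega
  have hanti : Fintype.card (Σ i, E i) / 2 =
      ∑ c, (if Ar c ≤ antiWeights (E := Yc c) ρ then
        (∑ i, Fintype.card (JJ i c)) * Module.finrank ℚ (Ar c) else 0) := by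
    rw [card_sigma_div_two h]
    have hslot : ∀ i, Fintype.card (E i) / 2 =
        ∑ c, (if Ar c ≤ antiWeights (E := Yc c) ρ then
          Fintype.card (JJ i c) * Module.finrank ℚ (Ar c) else 0) := fun i => by
      rw [← hhalf i, finrank_antiWeights_eq_sum_odd hcomm hinv hRst hRirr hsep (ι i) (hιeq i) (hind i) (htop i),
        ← Finset.sum_filter, Finset.sum_subtype (Finset.univ.filter fun c => Ar c ≤ antiWeights (E := Yc c) ρ)
          (fun c => by rw [Finset.mem_filter, and_iff_right (Finset.mem_univ c)])]
    rw [Finset.sum_congr rfl fun i _ => hslot i, Finset.sum_comm]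
    refine Finset.sum_congr rfl fun c _ => ?_
    by_cases hc : Ar c ≤ antiWeights (E := Yc c) ρ
    · simp only [if_pos hc, Finset.sum_mul]
    · simp only [if_neg hc, Finset.sum_const_zero]
  -- term-by-term comparison
  have hle : ∀ c ∈ (Finset.univ : Finset C), r c * Module.finrank ℚ (Ar c) ≤
      (if Ar c ≤ antiWeights (E := Yc c) ρ then
        (∑ i, Fintype.card (JJ i c)) * Module.finrank ℚ (Ar c) else 0) := by
    intro c _
    by_cases hc : Ar c ≤ antiWeights (E := Yc c) ρ
    · rw [if_pos hc]
      exact Nat.mul_le_mul_right _ (hr c)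
    · rw [if_neg hc, hr0 c hc, zero_mul]
  rw [hS, hanti]
  constructor
  · intro heq c hc
    have h1 := (Finset.sum_eq_sum_iff_of_le hle).1 (Nat.add_right_cancel heq) c (Finset.mem_univ c)
    rw [if_pos hc] at h1
    rw [hD c, Nat.eq_of_mul_eq_mul_right (hd c) h1]
  · intro hfree
    congr 1
    refine (Finset.sum_eq_sum_iff_of_le hle).2 fun c _ => ?_
    by_cases hc : Ar c ≤ antiWeights (E := Yc c) ρ
    · rw [if_pos hc]
      have h1 := hfree c hc
      rw [hD c] at h1
      rw [Nat.eq_of_mul_eq_mul_right (hδ c) h1]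
    · rw [if_neg hc, hr0 c hc, zero_mul]

end Family

/-! ### §2 With no input but the types -/

section NoInput

variable {I : Type u} {E : I → Type v} [∀ i, MulAction G (E i)] [∀ i, Fintype (E i)] [Fintype I]
  [∀ i, Nonempty (E i)]

/-- **STABLE NONDEGENERACY CLASS BY CLASS, WITH NO INPUT BUT THE TYPES.**  For every family of CM types `Φ_i ⊆ E_i`
(`I` non-empty) there is an isotypic decomposition of the type vectors (references `A_c ≤ ℚ^{⊔_i E_i}`, commutants
`𝒟_c`, multiplicities `m_{i,c}`, embeddings, components `b^i_{c,j}`, non-zero `a₀_c ∈ A_c`) such that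
**`rank Σ = |⊔_i E_i|/2 + 1 ⟺ ∀ c` with `A_c` odd, `dim ⨆_i ⨆_j 𝒟_c·b^i_{c,j} = (Σ_i m_{i,c})·dim 𝒟_c·a₀_c`**.
[cite: Kubota1965, §2 (p. 115)] [cite: Gordon1999HodgeAVSurvey, 7.5–7.6] -/
theorem exists_isotypic_typeRank_sigmaType_eq_iff_forall_odd [Nonempty I] {Φ : ∀ i, Set (E i)}
    (h : ∀ i, IsCMTypeWith ρ (Φ i)) :
    ∃ (n : ℕ) (Ar : Fin n → Submodule ℚ ((Σ i, E i) → ℚ))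
      (𝒟 : Fin n → Submodule ℚ (((Σ i, E i) → ℚ) →ₗ[ℚ] ((Σ i, E i) → ℚ))) (m : I → Fin n → ℕ)
      (ι : ∀ (i : I) (c : Fin n), Fin (m i c) → (((Σ i, E i) → ℚ) →ₗ[ℚ] (E i → ℚ)))
      (b : ∀ (i : I) (c : Fin n), Fin (m i c) → ((Σ i, E i) → ℚ)) (a₀ : Fin n → ((Σ i, E i) → ℚ)),
      (∀ (c : Fin n) (L : ((Σ i, E i) → ℚ) →ₗ[ℚ] ((Σ i, E i) → ℚ)), L ∈ 𝒟 c ↔ (∀ a ∈ Ar c, L a ∈ Ar c) ∧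
        ∀ (k : G) (a : (Σ i, E i) → ℚ), a ∈ Ar c → L (fun x => a (k • x)) = fun x => L a (k • x)) ∧
      (∀ (c : Fin n) (k : G) (a : (Σ i, E i) → ℚ), a ∈ Ar c → (fun x => a (k • x)) ∈ Ar c) ∧
      (∀ (c : Fin n) (W : Submodule ℚ ((Σ i, E i) → ℚ)), W ≤ Ar c → W ≠ ⊥ →
        (∀ (k : G) (f : (Σ i, E i) → ℚ), f ∈ W → (fun x => f (k • x)) ∈ W) → W = Ar c) ∧
      (∀ c : Fin n, Ar c ≠ ⊥) ∧
      (∀ (c c' : Fin n) (L : ((Σ i, E i) → ℚ) →ₗ[ℚ] ((Σ i, E i) → ℚ)), c ≠ c' → Ar c ≠ ⊥ →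
        (∀ a ∈ Ar c, L a ∈ Ar c') → (∀ a ∈ Ar c, L a = 0 → a = 0) →
        (∀ (k : G) (a : (Σ i, E i) → ℚ), a ∈ Ar c → L (fun x => a (k • x)) = fun x => L a (k • x)) →
        False) ∧
      (∀ (i : I) (c : Fin n) (j : Fin (m i c)) (k : G) (a : (Σ i, E i) → ℚ), a ∈ Ar c →
        ι i c j (fun x => a (k • x)) = fun s => ι i c j a (k • s)) ∧
      (∀ (i : I) (c : Fin n) (f : Fin (m i c) → ((Σ i, E i) → ℚ)), (∀ j, f j ∈ Ar c) →
        ∑ j, ι i c j (f j) = 0 → ∀ j, f j = 0) ∧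
      (∀ i c j, b i c j ∈ Ar c) ∧ (∀ i, antiVec (Φ i) (1 : G) = ∑ c, ∑ j, ι i c j (b i c j)) ∧
      (∀ c, a₀ c ∈ Ar c) ∧ (∀ c, a₀ c ≠ 0) ∧
      (typeRank G (sigmaType Φ) = Fintype.card (Σ i, E i) / 2 + 1 ↔
        ∀ c, Ar c ≤ antiWeights (E := Σ i, E i) ρ →
          Module.finrank ℚ ↥(⨆ i, ⨆ j, (𝒟 c).map (LinearMap.applyₗ (b i c j))) =
            (∑ i, m i c) * Module.finrank ℚ ↥((𝒟 c).map (LinearMap.applyₗ (a₀ c)))) := by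
  obtain ⟨n, Ar, m, ι, hRst, hRirr, hR0, hsep, hιeq, hind, -, htop, hdec⟩ :=
    exists_isotypic_decomposition (G := G) (E := E)
  obtain ⟨𝒟, h𝒟⟩ := exists_commutants (G := G) Ar
  obtain ⟨a₀, ha₀, h0⟩ := exists_mem_ne_zero_of_forall_ne_bot hR0
  obtain ⟨b, hb, hu⟩ := hdec fun i => antiVec (Φ i) (1 : G)
  have hcomm : ∀ (g : G) (y : Σ i, E i), g • ρ • y = ρ • g • y := by
    rintro g ⟨i, s⟩
    change (⟨i, g • ρ • s⟩ : Σ i, E i) = ⟨i, ρ • g • s⟩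
    rw [(h i).comm g s]
  have hinv : ∀ y : Σ i, E i, ρ • ρ • y = y := by
    rintro ⟨i, s⟩
    change (⟨i, ρ • ρ • s⟩ : Σ i, E i) = ⟨i, s⟩
    rw [(h i).invol s]
  refine ⟨n, Ar, 𝒟, m, ι, b, a₀, h𝒟, hRst, hRirr, hR0, hsep, hιeq, hind, hb, hu, ha₀, h0, ?_⟩
  have h1 := typeRank_sigmaType_eq_iff_forall_odd_finrank_eq (Yc := fun _ : Fin n => Σ i, E i)
    (JJ := fun i c => Fin (m i c)) h (fun _ => hcomm) (fun _ => hinv) h𝒟 hRst hRirr hsep ι hιeq hind hb hu ha₀ h0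
    htop
  simp only [Fintype.card_fin] at h1
  exact h1

end NoInput

end Summit.HodgeConjecture.CorCM.IrrOdd

/-! ### §3 CM fields -/

namespace Summit.HodgeConjecture.CorCM

open CategoryTheory CategoryTheory.Limits NumberField Module IntermediateField
open Literature.NumberTheory.ComplexMultiplication
open Literature.AlgebraicGeometry.Motives (AbelianVariety CMType)
open Literature.AlgebraicGeometry.Motives.AbelianVariety
open Literature.AlgebraicGeometry.HodgeTheory
open Literature.AlgebraicGeometry.ComplexMultiplication (IsCMTypeRealisation)
open Literature.AlgebraicGeometry.Pohlmann1968

variable {I : Type} [Fintype I] {K : I → Type} [∀ i, Field (K i)] [∀ i, NumberField (K i)] [∀ i, IsCMField (K i)]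

/-- **STABLE NONDEGENERACY OF A PRODUCT OF CM ABELIAN VARIETIES CLASS BY CLASS, WITH NO INPUT BUT THE CM TYPES.**
For CM fields `K_i` and CM types `Φ_i` (`I` non-empty) there is an isotypic decomposition of the type vectors over
pairwise non-embeddable `Aut(ℂ)`-stable irreducibles `A_c ≤ ℚ^{⊔_i Hom(K_i, ℂ)}` (commutants `𝒟_c`, multiplicities
`m_{i,c}`, components `b^i_{c,j}`, non-zero `a₀_c ∈ A_c`) such that **`∏_i A_{Φ_i}` is STABLY NONDEGENERATE
(`IsNondegenerateFamily Φ`: `dim Hg(∏_i A_i) = Σ_i dim A_i`, no power carries an exotic Hodge class) iff for every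
class `c` with `A_c` ODD under complex conjugation, `dim ⨆_i ⨆_j 𝒟_c·b^i_{c,j} = (Σ_i m_{i,c})·dim 𝒟_c·a₀_c`** —
the components of ALL the type vectors in the class are jointly `𝒟_c`-free. [cite: Kubota1965, §2 (p. 115)]
[cite: Gordon1999HodgeAVSurvey, 7.5–7.6] [cite: Milne1999LefschetzClasses, Prop. 4.8] -/
theorem exists_isotypic_isNondegenerateFamily_iff_forall_odd [Nonempty I] (Φ : ∀ i, CMType (K i)) :
    ∃ (n : ℕ) (Ar : Fin n → Submodule ℚ ((Σ i, (K i →+* ℂ)) → ℚ))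
      (𝒟 : Fin n → Submodule ℚ (((Σ i, (K i →+* ℂ)) → ℚ) →ₗ[ℚ] ((Σ i, (K i →+* ℂ)) → ℚ)))
      (m : I → Fin n → ℕ)
      (ι : ∀ (i : I) (c : Fin n), Fin (m i c) → (((Σ i, (K i →+* ℂ)) → ℚ) →ₗ[ℚ] ((K i →+* ℂ) → ℚ)))
      (b : ∀ (i : I) (c : Fin n), Fin (m i c) → ((Σ i, (K i →+* ℂ)) → ℚ))
      (a₀ : Fin n → ((Σ i, (K i →+* ℂ)) → ℚ)),
      (∀ (c : Fin n) (L : ((Σ i, (K i →+* ℂ)) → ℚ) →ₗ[ℚ] ((Σ i, (K i →+* ℂ)) → ℚ)), L ∈ 𝒟 c ↔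
        (∀ a ∈ Ar c, L a ∈ Ar c) ∧ ∀ (k : ℂ ≃+* ℂ) (a : (Σ i, (K i →+* ℂ)) → ℚ), a ∈ Ar c →
          L (fun x => a (k • x)) = fun x => L a (k • x)) ∧
      (∀ (c : Fin n) (k : ℂ ≃+* ℂ) (a : (Σ i, (K i →+* ℂ)) → ℚ), a ∈ Ar c → (fun x => a (k • x)) ∈ Ar c) ∧
      (∀ (c : Fin n) (W : Submodule ℚ ((Σ i, (K i →+* ℂ)) → ℚ)), W ≤ Ar c → W ≠ ⊥ →
        (∀ (k : ℂ ≃+* ℂ) (f : (Σ i, (K i →+* ℂ)) → ℚ), f ∈ W → (fun x => f (k • x)) ∈ W) → W = Ar c) ∧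
      (∀ c : Fin n, Ar c ≠ ⊥) ∧
      (∀ (c c' : Fin n) (L : ((Σ i, (K i →+* ℂ)) → ℚ) →ₗ[ℚ] ((Σ i, (K i →+* ℂ)) → ℚ)), c ≠ c' → Ar c ≠ ⊥ →
        (∀ a ∈ Ar c, L a ∈ Ar c') → (∀ a ∈ Ar c, L a = 0 → a = 0) →
        (∀ (k : ℂ ≃+* ℂ) (a : (Σ i, (K i →+* ℂ)) → ℚ), a ∈ Ar c →
          L (fun x => a (k • x)) = fun x => L a (k • x)) → False) ∧
      (∀ (i : I) (c : Fin n) (j : Fin (m i c)) (k : ℂ ≃+* ℂ) (a : (Σ i, (K i →+* ℂ)) → ℚ), a ∈ Ar c →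
        ι i c j (fun x => a (k • x)) = fun s => ι i c j a (k • s)) ∧
      (∀ (i : I) (c : Fin n) (f : Fin (m i c) → ((Σ i, (K i →+* ℂ)) → ℚ)), (∀ j, f j ∈ Ar c) →
        ∑ j, ι i c j (f j) = 0 → ∀ j, f j = 0) ∧
      (∀ i c j, b i c j ∈ Ar c) ∧
      (∀ i, antiVec (Φ i).1 (1 : ℂ ≃+* ℂ) = ∑ c, ∑ j, ι i c j (b i c j)) ∧
      (∀ c, a₀ c ∈ Ar c) ∧ (∀ c, a₀ c ≠ 0) ∧
      (CMAlgebra.IsNondegenerateFamily Φ ↔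
        ∀ c, Ar c ≤ antiWeights (E := Σ i, (K i →+* ℂ)) (starRingAut : ℂ ≃+* ℂ) →
          Module.finrank ℚ ↥(⨆ i, ⨆ j, (𝒟 c).map (LinearMap.applyₗ (b i c j))) =
            (∑ i, m i c) * Module.finrank ℚ ↥((𝒟 c).map (LinearMap.applyₗ (a₀ c)))) := by
  haveI : ∀ i, Nonempty (K i →+* ℂ) := fun i => inferInstance
  obtain ⟨n, Ar, 𝒟, m, ι, b, a₀, h𝒟, hRst, hRirr, hR0, hsep, hιeq, hind, hb, hu, ha₀, h0, hcrit⟩ :=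
    IrrOdd.exists_isotypic_typeRank_sigmaType_eq_iff_forall_odd (G := ℂ ≃+* ℂ) (E := fun i => K i →+* ℂ)
      (Φ := fun i => (Φ i).1) fun i => isCMTypeWith_conj (Φ i)
  refine ⟨n, Ar, 𝒟, m, ι, b, a₀, h𝒟, hRst, hRirr, hR0, hsep, hιeq, hind, hb, hu, ha₀, h0, ?_⟩
  have hcard : (∑ i, Module.finrank ℚ (K i)) = Fintype.card (Σ i, (K i →+* ℂ)) := by
    rw [Fintype.card_sigma]
    exact Finset.sum_congr rfl fun i _ => (NumberField.Embeddings.card (K i) ℂ).symm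
  rw [CMAlgebra.isNondegenerateFamily_iff, hcard]
  exact hcrit

end Summit.HodgeConjecture.CorCM

end
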